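import Summits.HubbardSuperconductivity.HubbardSuperconductivity.Theorems.AnisotropyChordTransferFibre3B1WLoop
import Summits.HubbardSuperconductivity.HubbardSuperconductivity.Theorems.AnisotropyChordTransferFibre3Symmetry
import Summits.HubbardSuperconductivity.HubbardSuperconductivity.Theorems.AnisotropyChordTransferFibre3PlaneWave

/-!
# Route `AnisotropyChord` / H0 rotor rung, row D (KT-2a) Stage 2: the `{G, GW, GW}` family in the affine-leg language —
reindexing to the B1 weighted-loop object, the Cauchy–Schwarz/`WS` form, and the certified bounds

`…RowDLoopSums.fam_gww` / `…RowDLoopW.fam_gwwC` bound the `SSS` N-loop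
`Σ_p g(ℓ₀p)·(w_{e₁}g)(ℓ₁p)·(w_{e₂}g)(ℓ₂p)` (`ℓ_i p = affine σ_i c_i p = c_i ± p`) by `c·S₂`.  THIS FILE supplies the Stage-2
replacements on top of the weighted-upper B1 bracket `…Fibre3B1WLoop{,Bracket}` / kernel certificate `…Fibre3B1WEval`:
* `wnorm_neg`, `wnorm_neg_right`, `wloopSum_neg_e₁/e₂` (the tables need only `e ∈ {(1,0),(0,1)}`), `mixShift σ₁ σ₀ c₁ c₀` (`= c₁ − c₀` if `σ₁ = σ₀`, else `−(c₁ + c₀)`), ★ `wg_affine_eq`: `(w g)(ℓ₁p) = (w g)(ℓ₀p + d₁)`,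
  `d_i = mixShift σ_i σ₀ c_i c₀` (evenness of `g` and of `w_e`);
* ★ `loop3_affine_eq` (DIRECT form): `Σ_p g(ℓ₀p)(w₁g)(ℓ₁p)(w₂g)(ℓ₂p) = Σ_q g(q)(w₁g)(q+d₁)(w₂g)(q+d₂)`, and ★ `loop3_eq_wloopSum`: for
  `d_i = toTor d̄_i`, `e_i = toTor ē_i` this is `B1.wloopSum L λ₂ 0 d̄₁ d̄₂ ē₁ ē₂` — ONE certified rational per (class, translate, pattern,
  `e, e′`) via `B1.w_sound`;
* ★ `WSt e d = Σ_q g(q)·((w_e g)(q+d))²`, `WSt_eq_wloopSum` (`= B1.wloopSum L λ₂ 0 d̄ d̄ ē ē`), ★★ `fam_gww_WS` (Cauchy–Schwarz form):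
  `Σ_p g(ℓ₀p)(w₁g)(ℓ₁p)(w₂g)(ℓ₂p) ≤ √(WSt e₁ d₁ · WSt e₂ d₂)` — the `WS(e,r)` route of p1 g30 FINAL NEXT (5) (16 objects per ν-band);
* ★★ `fam_gww_direct_cert`, ★★ `fam_gww_WS_cert`: the same with certified constants `χ` (`θ⁴·wloopSum ≤ χ`): `≤ χ/θ⁴` resp.
  `≤ √(χ₁χ₂)/θ⁴` — drop-in for the `c·S₂ = c·Ŝ₂/t²` entries of `bnd3`.
Forecast (exact torus sums, L = 128, per (k₂,k₃)-translate object summed over `e ∈ E4` and the three patterns, units `θ⁻⁴`):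
Stage 1 `12c_ZŜ₂` 182–202, Stage 1.5 `12c_WŜ₂` 73–78, CS/`WS` 21–30, direct 13–22 (p2 g7 INBOX 2026-08-30).
Prover seat `hubbard-h0-rotor-p2` g7; helper for piece A = stmt-HubbardSuperconductivity-23918 of rung 19089
(`--supports`, helper class).  Nothing here proves superconductivity in the Hubbard model; lemmas for ONE row of ONE conditional
reduction; the rotor TARGET as originally worded stays FALSE (g15 verdict).  Tree imports only; no sorry.
-/

set_option linter.dupNamespace false
set_option autoImplicit false

noncomputable section

open scoped BigOperators

namespace Summit.HubbardSuperconductivity.HubbardSuperconductivity.Theorems.AnisotropyChord.Transfer.Fibre3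

namespace RowD

open RowC L2.N1

variable (L : ℕ) [NeZero L]

/-! ## Evenness of the gradient weight and the combined shift of two affine legs -/

/-- `w_e(−q) = w_e(q)`. [folklore] -/
theorem wnorm_neg (q e : Tor L) : wnorm L (-q) e = wnorm L q e := by
  unfold wnorm
  rw [phase_neg_left, ← conj_phase, Complex.conj_conj]
  have h : (1 : ℂ) - phase L q e = (starRingEnd ℂ) ((1 : ℂ) - (starRingEnd ℂ) (phase L q e)) := by
    simp only [map_sub, map_one, Complex.conj_conj]
  rw [h, Complex.norm_conj]

/-- `w_{−e}(q) = w_e(q)`. [folklore] -/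
theorem wnorm_neg_right (q e : Tor L) : wnorm L q (-e) = wnorm L q e := by
  unfold wnorm
  rw [← conj_phase, Complex.conj_conj]
  have h : (1 : ℂ) - phase L q e = (starRingEnd ℂ) ((1 : ℂ) - (starRingEnd ℂ) (phase L q e)) := by
    simp only [map_sub, map_one, Complex.conj_conj]
  rw [h, Complex.norm_conj]

/-- the B1 weighted-loop object is even in the first weight direction. [folklore] -/
theorem wloopSum_neg_e₁ (lam : ℝ) (s₀ s₁ s₂ e₁ e₂ : ℤ × ℤ) :
    B1.wloopSum L lam s₀ s₁ s₂ (-e₁) e₂ = B1.wloopSum L lam s₀ s₁ s₂ e₁ e₂ := by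
  unfold B1.wloopSum
  simp only [B1.toTor_neg, wnorm_neg_right]

/-- the B1 weighted-loop object is even in the second weight direction. [folklore] -/
theorem wloopSum_neg_e₂ (lam : ℝ) (s₀ s₁ s₂ e₁ e₂ : ℤ × ℤ) :
    B1.wloopSum L lam s₀ s₁ s₂ e₁ (-e₂) = B1.wloopSum L lam s₀ s₁ s₂ e₁ e₂ := by
  unfold B1.wloopSum
  simp only [B1.toTor_neg, wnorm_neg_right]

/-- the combined shift `d₁` with `ℓ₁p = ±(ℓ₀p + d₁)`: `c₁ − c₀` if the two legs have the same sign, `−(c₁ + c₀)` otherwise. -/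
def mixShift (σ₁ σ₀ : Bool) (c₁ c₀ : Tor L) : Tor L := if σ₁ = σ₀ then c₁ - c₀ else -(c₁ + c₀)

section legs
variable (lam2 : ℝ)

/-- ★ a weighted leg read through the plain leg: `(w_e g)(ℓ₁p) = (w_e g)(ℓ₀p + d₁)`, `d₁ = mixShift σ₁ σ₀ c₁ c₀`. [folklore] -/
theorem wg_affine_eq (σ₀ : Bool) (c₀ : Tor L) (σ₁ : Bool) (c₁ : Tor L) (e p : Tor L) :
    wnorm L (affine L σ₁ c₁ p) e * gres L lam2 (affine L σ₁ c₁ p)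
      = wnorm L (affine L σ₀ c₀ p + mixShift L σ₁ σ₀ c₁ c₀) e * gres L lam2 (affine L σ₀ c₀ p + mixShift L σ₁ σ₀ c₁ c₀) := by
  unfold mixShift affine
  cases σ₀ <;> cases σ₁ <;> simp only [Bool.false_eq_true, Bool.true_eq_false, if_true, if_false]
  · congr 2 <;> abel
  · have e1 : c₁ - p = -(c₀ + p + -(c₁ + c₀)) := by abel
    rw [e1, wnorm_neg, B1.gres_neg]
  · have e1 : c₁ + p = -(c₀ - p + -(c₁ + c₀)) := by abel
    rw [e1, wnorm_neg, B1.gres_neg]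
  · congr 2 <;> abel

/-- a plain leg read through the plain leg `ℓ₀`: `g(ℓ₁p) = g(ℓ₀p + d₁)`. [folklore] -/
theorem g_affine_eq (σ₀ : Bool) (c₀ : Tor L) (σ₁ : Bool) (c₁ : Tor L) (p : Tor L) :
    gres L lam2 (affine L σ₁ c₁ p) = gres L lam2 (affine L σ₀ c₀ p + mixShift L σ₁ σ₀ c₁ c₀) := by
  unfold mixShift affine
  cases σ₀ <;> cases σ₁ <;> simp only [Bool.false_eq_true, Bool.true_eq_false, if_true, if_false]
  · congr 1; abel
  · have e1 : c₁ - p = -(c₀ + p + -(c₁ + c₀)) := by abel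
    rw [e1, B1.gres_neg]
  · have e1 : c₁ + p = -(c₀ - p + -(c₁ + c₀)) := by abel
    rw [e1, B1.gres_neg]
  · congr 1; abel

/-! ## The direct form: the whole triple product is ONE B1 weighted-loop object -/

/-- ★ DIRECT reindexing: `Σ_p g(ℓ₀p)(w₁g)(ℓ₁p)(w₂g)(ℓ₂p) = Σ_q g(q)·(w₁g)(q + d₁)·(w₂g)(q + d₂)`. [folklore] -/
theorem loop3_affine_eq (σ₀ : Bool) (c₀ : Tor L) (σ₁ : Bool) (c₁ : Tor L) (σ₂ : Bool) (c₂ : Tor L) (e₁ e₂ : Tor L) :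
    ∑ p : Tor L, gres L lam2 (affine L σ₀ c₀ p) * (wnorm L (affine L σ₁ c₁ p) e₁ * gres L lam2 (affine L σ₁ c₁ p))
        * (wnorm L (affine L σ₂ c₂ p) e₂ * gres L lam2 (affine L σ₂ c₂ p))
      = ∑ q : Tor L, gres L lam2 q * (wnorm L (q + mixShift L σ₁ σ₀ c₁ c₀) e₁ * gres L lam2 (q + mixShift L σ₁ σ₀ c₁ c₀))
        * (wnorm L (q + mixShift L σ₂ σ₀ c₂ c₀) e₂ * gres L lam2 (q + mixShift L σ₂ σ₀ c₂ c₀)) := by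
  rw [← sum_comp_affine L (fun q => gres L lam2 q * (wnorm L (q + mixShift L σ₁ σ₀ c₁ c₀) e₁ * gres L lam2 (q + mixShift L σ₁ σ₀ c₁ c₀))
        * (wnorm L (q + mixShift L σ₂ σ₀ c₂ c₀) e₂ * gres L lam2 (q + mixShift L σ₂ σ₀ c₂ c₀))) σ₀ c₀]
  refine Finset.sum_congr rfl fun p _ => ?_
  rw [wg_affine_eq L lam2 σ₀ c₀ σ₁ c₁ e₁ p, wg_affine_eq L lam2 σ₀ c₀ σ₂ c₂ e₂ p]

/-- ★ the direct form IS the B1 object: for integer data `d_i = toTor d̄_i`, `e_i = toTor ē_i`,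
`Σ_q g(q)(w₁g)(q+d₁)(w₂g)(q+d₂) = B1.wloopSum L λ₂ 0 d̄₁ d̄₂ ē₁ ē₂`. [folklore] -/
theorem loop3_eq_wloopSum (d₁ d₂ e₁ e₂ : ℤ × ℤ) :
    ∑ q : Tor L, gres L lam2 q * (wnorm L (q + B1.toTor L d₁) (B1.toTor L e₁) * gres L lam2 (q + B1.toTor L d₁))
        * (wnorm L (q + B1.toTor L d₂) (B1.toTor L e₂) * gres L lam2 (q + B1.toTor L d₂))
      = B1.wloopSum L lam2 0 d₁ d₂ e₁ e₂ := by
  unfold B1.wloopSum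
  rw [B1.toTor_zero]
  simp only [add_zero]

/-! ## The Cauchy–Schwarz / `WS` form -/

/-- ★ the weighted two-propagator square sum `WS_e(d) = Σ_q g(q)·((w_e g)(q + d))²`. -/
def WSt (e d : Tor L) : ℝ := ∑ q : Tor L, gres L lam2 q * (wnorm L (q + d) e * gres L lam2 (q + d)) ^ 2

/-- `WS ≥ 0` in the regime `ν < 4/π²`. [folklore] -/
theorem WSt_nonneg (hν : lam2 / (2 * Real.pi / L) ^ 2 < 4 / Real.pi ^ 2) (e d : Tor L) : 0 ≤ WSt L lam2 e d :=
  Finset.sum_nonneg fun q _ => mul_nonneg (g_nonneg L hν q) (sq_nonneg _)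

/-- ★ `WS` IS a B1 object: `WS_{toTor ē}(toTor d̄) = B1.wloopSum L λ₂ 0 d̄ d̄ ē ē`. [folklore] -/
theorem WSt_eq_wloopSum (e d : ℤ × ℤ) : WSt L lam2 (B1.toTor L e) (B1.toTor L d) = B1.wloopSum L lam2 0 d d e e := by
  rw [← loop3_eq_wloopSum]
  unfold WSt
  refine Finset.sum_congr rfl fun q _ => ?_
  ring

/-- Cauchy–Schwarz with a nonnegative weight: `Σ g₀A₁A₂ ≤ √(Σ g₀A₁²)·√(Σ g₀A₂²)`. [folklore] -/
theorem sum_three_le_sqrt {ι : Type*} [Fintype ι] {g₀ A₁ A₂ : ι → ℝ} (hg₀ : ∀ i, 0 ≤ g₀ i) :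
    ∑ i, g₀ i * A₁ i * A₂ i ≤ Real.sqrt (∑ i, g₀ i * A₁ i ^ 2) * Real.sqrt (∑ i, g₀ i * A₂ i ^ 2) := by
  have h := sum_mul_le_sqrt (fun i => Real.sqrt (g₀ i) * A₁ i) (fun i => Real.sqrt (g₀ i) * A₂ i)
  have e0 : ∀ i, (Real.sqrt (g₀ i) * A₁ i) * (Real.sqrt (g₀ i) * A₂ i) = g₀ i * A₁ i * A₂ i := by
    intro i
    have := Real.mul_self_sqrt (hg₀ i)
    calc (Real.sqrt (g₀ i) * A₁ i) * (Real.sqrt (g₀ i) * A₂ i) = (Real.sqrt (g₀ i) * Real.sqrt (g₀ i)) * A₁ i * A₂ i := by ring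
      _ = g₀ i * A₁ i * A₂ i := by rw [this]
  have e1 : ∀ i, (Real.sqrt (g₀ i) * A₁ i) ^ 2 = g₀ i * A₁ i ^ 2 := by
    intro i; rw [mul_pow, Real.sq_sqrt (hg₀ i)]
  have e2 : ∀ i, (Real.sqrt (g₀ i) * A₂ i) ^ 2 = g₀ i * A₂ i ^ 2 := by
    intro i; rw [mul_pow, Real.sq_sqrt (hg₀ i)]
  simp only [e0, e1, e2] at h
  exact h

/-- ★★ THE `{G, GW, GW}` FAMILY IN `WS` FORM: `Σ_p g(ℓ₀p)(w₁g)(ℓ₁p)(w₂g)(ℓ₂p) ≤ √(WS_{e₁}(d₁)·WS_{e₂}(d₂))`,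
`d_i = mixShift σ_i σ₀ c_i c₀`. [folklore] -/
theorem fam_gww_WS (hν : lam2 / (2 * Real.pi / L) ^ 2 < 4 / Real.pi ^ 2)
    (σ₀ : Bool) (c₀ : Tor L) (σ₁ : Bool) (c₁ : Tor L) (σ₂ : Bool) (c₂ : Tor L) (e₁ e₂ : Tor L) :
    ∑ p : Tor L, gres L lam2 (affine L σ₀ c₀ p) * (wnorm L (affine L σ₁ c₁ p) e₁ * gres L lam2 (affine L σ₁ c₁ p))
        * (wnorm L (affine L σ₂ c₂ p) e₂ * gres L lam2 (affine L σ₂ c₂ p))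
      ≤ Real.sqrt (WSt L lam2 e₁ (mixShift L σ₁ σ₀ c₁ c₀) * WSt L lam2 e₂ (mixShift L σ₂ σ₀ c₂ c₀)) := by
  rw [loop3_affine_eq, Real.sqrt_mul (WSt_nonneg L lam2 hν _ _)]
  unfold WSt
  exact sum_three_le_sqrt fun q => g_nonneg L hν q

/-! ## The certified forms (constants from `B1.w_sound`) -/

/-- ★★ DIRECT certified bound: if `θ⁴·B1.wloopSum L λ₂ 0 d̄₁ d̄₂ ē₁ ē₂ ≤ χ` then
`Σ_p g(ℓ₀p)(w₁g)(ℓ₁p)(w₂g)(ℓ₂p) ≤ χ/θ⁴` whenever `mixShift σ_i σ₀ c_i c₀ = toTor d̄_i`, `e_i = toTor ē_i`. [folklore] -/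
theorem fam_gww_direct_cert (σ₀ : Bool) (c₀ : Tor L) (σ₁ : Bool) (c₁ : Tor L) (σ₂ : Bool) (c₂ : Tor L)
    (d₁ d₂ e₁ e₂ : ℤ × ℤ) (hd₁ : mixShift L σ₁ σ₀ c₁ c₀ = B1.toTor L d₁) (hd₂ : mixShift L σ₂ σ₀ c₂ c₀ = B1.toTor L d₂)
    {χ : ℝ} (hχ : ((2 * Real.pi / L) ^ 2) ^ 2 * B1.wloopSum L lam2 0 d₁ d₂ e₁ e₂ ≤ χ) :
    ∑ p : Tor L, gres L lam2 (affine L σ₀ c₀ p) * (wnorm L (affine L σ₁ c₁ p) (B1.toTor L e₁) * gres L lam2 (affine L σ₁ c₁ p))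
        * (wnorm L (affine L σ₂ c₂ p) (B1.toTor L e₂) * gres L lam2 (affine L σ₂ c₂ p))
      ≤ χ / ((2 * Real.pi / L) ^ 2) ^ 2 := by
  have hLpos : (0 : ℝ) < L := by exact_mod_cast Nat.pos_of_ne_zero (NeZero.ne L)
  have ht : 0 < ((2 * Real.pi / L) ^ 2) ^ 2 := by positivity
  rw [loop3_affine_eq, hd₁, hd₂, loop3_eq_wloopSum, le_div_iff₀ ht, mul_comm]
  exact hχ

/-- ★★ `WS` certified bound: if `θ⁴·B1.wloopSum L λ₂ 0 d̄_i d̄_i ē_i ē_i ≤ χ_i` (`i = 1, 2`, `χ_i ≥ 0`) then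
`Σ_p g(ℓ₀p)(w₁g)(ℓ₁p)(w₂g)(ℓ₂p) ≤ √(χ₁χ₂)/θ⁴` whenever `mixShift σ_i σ₀ c_i c₀ = toTor d̄_i`, `e_i = toTor ē_i`. [folklore] -/
theorem fam_gww_WS_cert (hν : lam2 / (2 * Real.pi / L) ^ 2 < 4 / Real.pi ^ 2)
    (σ₀ : Bool) (c₀ : Tor L) (σ₁ : Bool) (c₁ : Tor L) (σ₂ : Bool) (c₂ : Tor L)
    (d₁ d₂ e₁ e₂ : ℤ × ℤ) (hd₁ : mixShift L σ₁ σ₀ c₁ c₀ = B1.toTor L d₁) (hd₂ : mixShift L σ₂ σ₀ c₂ c₀ = B1.toTor L d₂)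
    {χ₁ χ₂ : ℝ} (hχ₁ : ((2 * Real.pi / L) ^ 2) ^ 2 * B1.wloopSum L lam2 0 d₁ d₁ e₁ e₁ ≤ χ₁)
    (hχ₂ : ((2 * Real.pi / L) ^ 2) ^ 2 * B1.wloopSum L lam2 0 d₂ d₂ e₂ e₂ ≤ χ₂) :
    ∑ p : Tor L, gres L lam2 (affine L σ₀ c₀ p) * (wnorm L (affine L σ₁ c₁ p) (B1.toTor L e₁) * gres L lam2 (affine L σ₁ c₁ p))
        * (wnorm L (affine L σ₂ c₂ p) (B1.toTor L e₂) * gres L lam2 (affine L σ₂ c₂ p))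
      ≤ Real.sqrt (χ₁ * χ₂) / ((2 * Real.pi / L) ^ 2) ^ 2 := by
  have hLpos : (0 : ℝ) < L := by exact_mod_cast Nat.pos_of_ne_zero (NeZero.ne L)
  set t2 : ℝ := ((2 * Real.pi / L) ^ 2) ^ 2 with ht2
  have ht : 0 < t2 := by positivity
  have h := fam_gww_WS L lam2 hν σ₀ c₀ σ₁ c₁ σ₂ c₂ (B1.toTor L e₁) (B1.toTor L e₂)
  rw [hd₁, hd₂, WSt_eq_wloopSum, WSt_eq_wloopSum] at h
  refine h.trans ?_
  rw [le_div_iff₀ ht]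
  have h1 : 0 ≤ B1.wloopSum L lam2 0 d₁ d₁ e₁ e₁ := by
    rw [← WSt_eq_wloopSum]; exact WSt_nonneg L lam2 hν _ _
  have h2 : 0 ≤ B1.wloopSum L lam2 0 d₂ d₂ e₂ e₂ := by
    rw [← WSt_eq_wloopSum]; exact WSt_nonneg L lam2 hν _ _
  calc Real.sqrt (B1.wloopSum L lam2 0 d₁ d₁ e₁ e₁ * B1.wloopSum L lam2 0 d₂ d₂ e₂ e₂) * t2
      = Real.sqrt ((t2 * B1.wloopSum L lam2 0 d₁ d₁ e₁ e₁) * (t2 * B1.wloopSum L lam2 0 d₂ d₂ e₂ e₂)) := by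
        rw [show (t2 * B1.wloopSum L lam2 0 d₁ d₁ e₁ e₁) * (t2 * B1.wloopSum L lam2 0 d₂ d₂ e₂ e₂)
            = (B1.wloopSum L lam2 0 d₁ d₁ e₁ e₁ * B1.wloopSum L lam2 0 d₂ d₂ e₂ e₂) * (t2 * t2) by ring,
          Real.sqrt_mul (mul_nonneg h1 h2), Real.sqrt_mul_self ht.le]
    _ ≤ Real.sqrt (χ₁ * χ₂) :=
        Real.sqrt_le_sqrt (mul_le_mul hχ₁ hχ₂ (mul_nonneg ht.le h2) ((mul_nonneg ht.le h1).trans hχ₁))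

end legs

end RowD

end Summit.HubbardSuperconductivity.HubbardSuperconductivity.Theorems.AnisotropyChord.Transfer.Fibre3

end
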